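import Literature.Topology.FourManifolds.SchoenfliesStepSubsphere
import Literature.Topology.FourManifolds.SchoenfliesStepTube
import Literature.Topology.FourManifolds.SweepDriver
import Literature.Topology.FourManifolds.SphereMorseCount
import Literature.Topology.FourManifolds.SweepFace
import Literature.Topology.FourManifolds.MorseExtrema
import Literature.Topology.FourManifolds.MorseProofs
import Literature.Topology.FourManifolds.AlexanderTools
import Literature.Topology.FourManifolds.BallFaceAlignment
import Literature.Topology.FourManifolds.SideComparison
import HarnessLib

/-!
# The inductive step of Alexander's theorem, II: the side of the sub-sphere, the orientation
# test, the sweep and the swept configuration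

Topic `Literature/Topology/FourManifolds`; top layer of the fact seat of Alexander's theorem
(`provefact-Literature.Topology.FourManifolds.SphereEmbedding.schoenflies_exists_ball`, Schultens
(2014), Thm. 3.2.5), continuing `SchoenfliesStepSubsphere.lean` (written under a take-the-blocker
claim from the Cerf seat `Literature.Topology.FourManifolds.cerf_pi0DiffDisc_relBoundary_three`).
**Everything in this file is proved; no definitions, no named facts.**

Part A — the side of the sub-sphere.  The sub-sphere `W = S₁` of the step ("`S₁` … bounds a
`3`-ball `B`", Schultens (2014), proof of Thm. 3.2.5, PDF p. 45) receives its side function from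
`CappedBallLid.exists_subSide`, whose certification hypothesis `hext` asks for a point of the kept
disc `D₊` strictly above (or below) all far points of the absorbed disc `D₋`.

* §A1 derives `hext` from "**a global maximum (or minimum) of the height lies on the kept disc**"
  (`SchoenfliesStep.hext_of_isMaxOn`, `SchoenfliesStep.hext_of_isMinOn`; strictness from the
  injectivity of the height on the critical set);
* §A2 packages the output of `exists_subSide` as a configuration
  (`SchoenfliesStep.exists_subConfig`: `SchoenfliesConfig.Config F_B f_B` together with the
  interface hypotheses of the sweep `SweepDriver.exists_sweepStep`);
* §A3 proves the **orientation test** (`SchoenfliesStep.false_of_extrema_over_absorbed`): it is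
  impossible that the absorbed disc carries no saddle but both a global maximum and a global
  minimum of the height — the smoothed sphere `W` over it would have a Morse height with no
  saddle and at least three critical points none of which is a saddle (the two global extrema
  and the apex), against `#min - #saddle + #max = 2` (`SphereMorseCount.morseCount_sphere_two`).
  Hence one of the two labellings of the discs always satisfies both "the absorbed disc has
  fewer saddles" and `hext` (the dichotomy is drawn in the induction file).

Part B — the sweep.  "By induction `S₁` bounds a `3`-ball, so Lemma 3.2.3 applies and `S` is
isotopic to `S₂`" (PDF p. 45).  The induction hypothesis arrives as a smooth embedding
`e_B : ℝ³ → ℝ³` with `e_B(∂𝔻³) = W`; it is turned into the ball parametrisation `Φ_B` consumed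
by the absorption `SweepDriver.exists_sweepStep` (§B2: `AlexanderTools.image_closedBall_eq_setOf_nonpos`
and the disc theorem `BallFaceAlignment.exists_diffeomorph_image_closedBall_eq`), and the swept
sphere `f_U = Φ_sw ∘ Φ_c ∘ f` is analysed:

* `SchoenfliesStep.exists_config_of_isMorse` (§B1) — **every smoothly embedded sphere with Morse
  height is a configuration** for a suitable side function (Jordan–Brouwer side function
  `AlexanderTools.exists_euclidean_sideFunction_connected`, made proper by
  `SideComparison.exists_properPos`);
* `SchoenfliesStep.exists_swept` (§B3) — the swept sphere: a smooth embedding `f_U = Θ ∘ f` (`Θ`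
  a diffeomorphism of `ℝ³`) with Morse height whose critical points are the critical points of
  the original height NOT over the absorbed disc `D₋` (same images, same germs of the height)
  and one new point, the bowl centre `p_c = (0, 0, 3s/8)`, a non-saddle with value `3s/8`;
  whose saddles are therefore the saddles off `D₋`; and whose level-`0` set is the original one
  with the closed box (the circle `α`) and the level circles of `D₋` removed;
* `SchoenfliesStep.ncard_components_level_lt` (§B4) — the number of level circles at height `0` drops ("`#|H' ∩ S|`", PDF p. 45; via
  `AlexanderTools.ncard_components_lt`).

## References
* J. Schultens, *Introduction to 3-Manifolds*, GSM 151, AMS (2014), Lemma 3.2.3 and proof of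
  Thm. 3.2.5 (PDF pp. 42–45).
* J. Milnor, *Morse theory*, Ann. of Math. Studies 51 (1963), §§2–3.
* M. W. Hirsch, *Differential Topology*, GTM 33 (1976), Ch. 8 §3 (disc theorem).
-/

noncomputable section

open Set Metric Filter Topology Function Module
open scoped ContDiff RealInnerProductSpace Manifold

namespace Literature.Topology.FourManifolds.SchoenfliesStep

open CappedBallLid SchoenfliesConfig SweepFace

/-! ## Part A — the side of the sub-sphere and the orientation test -/

open CappedBallLid SchoenfliesConfig SweepFace

/-! ### §A1 The certification point -/

section Ext

variable {f : sphere (0 : EuclideanSpace ℝ (Fin 3)) 1 → EuclideanSpace ℝ (Fin 3)}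
  {w₀ η₀ s : ℝ} {Dup Dlow : Set (EuclideanSpace ℝ (Fin 3))}

/-- The wall point `(1, 0, t)`: horizontal radius `1`, height `t`. [folklore] -/
theorem wallPoint_coords (t : ℝ) :
    hsq (EuclideanSpace.single (0 : Fin 3) (1 : ℝ) + t • EuclideanSpace.single (2 : Fin 3) (1 : ℝ)) = 1 ∧
      (EuclideanSpace.single (0 : Fin 3) (1 : ℝ) + t • EuclideanSpace.single (2 : Fin 3) (1 : ℝ)) 2 = t := by
  constructor
  · simp [hsq]
  · simp

/-- In tube normal form the wall point `(1, 0, t)`, `|t| ≤ η₀`, lies on the sphere. [folklore] -/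
theorem wallPoint_mem (hw₀ : 0 < w₀)
    (hwall : ∀ x : EuclideanSpace ℝ (Fin 3), hsq x ≤ (1 + 3 * w₀) ^ 2 → |x 2| ≤ η₀ →
      (x ∈ range f ↔ hsq x = 1)) {t : ℝ} (ht : |t| ≤ η₀) :
    EuclideanSpace.single (0 : Fin 3) (1 : ℝ) + t • EuclideanSpace.single (2 : Fin 3) (1 : ℝ) ∈ range f := by
  obtain ⟨h1, h2⟩ := wallPoint_coords t
  exact (hwall _ (by rw [h1]; nlinarith) (by rw [h2]; exact ht)).2 h1

/-- **`hext` from a global maximum on the kept disc.**  If the height is injective on its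
critical set and attains its maximum over the sphere at a point of the kept disc `D₊`, then that
point lies off the closed box, above height `s`, and strictly above every far point of the
absorbed disc `D₋`. [cite: Schultens2014, proof of Thm. 3.2.5 (PDF p. 45)] -/
theorem hext_of_isMaxOn (hw₀ : 0 < w₀) (hη₀ : 0 < η₀) (hs : 0 < s) (hsη : 20 * s ≤ η₀)
    (hwall : ∀ x : EuclideanSpace ℝ (Fin 3), hsq x ≤ (1 + 3 * w₀) ^ 2 → |x 2| ≤ η₀ →
      (x ∈ range f ↔ hsq x = 1))
    (hUnion : Dup ∪ Dlow = range f) (hInter : Dup ∩ Dlow = {x | hsq x = 1 ∧ x 2 = 0})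
    (hinj : InjOn (height f) (criticalSet (𝓡 2) (height f)))
    {y₀ : sphere (0 : EuclideanSpace ℝ (Fin 3)) 1} (hmax : IsMaxOn (height f) univ y₀)
    (hy₀ : f y₀ ∈ Dup) :
    ∃ q ∈ Dup, q ∉ closedBox s ∧
      ((s < q 2 ∧ ∀ p ∈ Dlow, p ∉ closedBox s → p 2 < q 2) ∨
        (q 2 < -(6 * s) ∧ ∀ p ∈ Dlow, p ∉ closedBox s → q 2 < p 2)) := by
  -- the height at `y₀` dominates the top wall point
  have hle : ∀ x ∈ range f, x 2 ≤ (f y₀) 2 := by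
    rintro _ ⟨y, rfl⟩
    have := hmax (mem_univ y)
    simpa [height_apply] using this
  obtain ⟨-, hu2⟩ := wallPoint_coords η₀
  have hu := hle _ (wallPoint_mem hw₀ hwall (t := η₀) (by rw [abs_of_pos hη₀]))
  rw [hu2] at hu
  refine ⟨f y₀, hy₀, fun hB => ?_, Or.inl ⟨by linarith, fun p hp hpB => ?_⟩⟩
  · have := hB.2.2; linarith
  · have hpr : p ∈ range f := hUnion ▸ Or.inr hp
    rcases (hle p hpr).lt_or_eq with h | h
    · exact h
    · exfalso
      obtain ⟨y₁, rfl⟩ := hpr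
      -- `y₁` is another global maximum, hence a critical point with the same critical value
      have hmax₁ : IsMaxOn (height f) univ y₁ := fun y _ => by
        have := hmax (mem_univ y)
        simp only [mem_setOf_eq, height_apply] at this ⊢
        linarith
      have hc₀ : IsMCriticalPt (𝓡 2) (height f) y₀ := IsLocalMax.isMCriticalPt (I := 𝓡 2) (hmax.isLocalMax univ_mem)
      have hc₁ : IsMCriticalPt (𝓡 2) (height f) y₁ := IsLocalMax.isMCriticalPt (I := 𝓡 2) (hmax₁.isLocalMax univ_mem)
      have heq : y₁ = y₀ := hinj hc₁ hc₀ (by rw [height_apply, height_apply, h])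
      rw [heq] at hp
      have : f y₀ ∈ Dup ∩ Dlow := ⟨hy₀, hp⟩
      rw [hInter] at this
      have := this.2
      linarith

/-- **`hext` from a global minimum on the kept disc** (the same, turned about).
[cite: Schultens2014, proof of Thm. 3.2.5 (PDF p. 45)] -/
theorem hext_of_isMinOn (hw₀ : 0 < w₀) (hη₀ : 0 < η₀) (hs : 0 < s) (hsη : 20 * s ≤ η₀)
    (hwall : ∀ x : EuclideanSpace ℝ (Fin 3), hsq x ≤ (1 + 3 * w₀) ^ 2 → |x 2| ≤ η₀ →
      (x ∈ range f ↔ hsq x = 1))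
    (hUnion : Dup ∪ Dlow = range f) (hInter : Dup ∩ Dlow = {x | hsq x = 1 ∧ x 2 = 0})
    (hinj : InjOn (height f) (criticalSet (𝓡 2) (height f)))
    {y₀ : sphere (0 : EuclideanSpace ℝ (Fin 3)) 1} (hmin : IsMinOn (height f) univ y₀)
    (hy₀ : f y₀ ∈ Dup) :
    ∃ q ∈ Dup, q ∉ closedBox s ∧
      ((s < q 2 ∧ ∀ p ∈ Dlow, p ∉ closedBox s → p 2 < q 2) ∨
        (q 2 < -(6 * s) ∧ ∀ p ∈ Dlow, p ∉ closedBox s → q 2 < p 2)) := by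
  have hle : ∀ x ∈ range f, (f y₀) 2 ≤ x 2 := by
    rintro _ ⟨y, rfl⟩
    have := hmin (mem_univ y)
    simpa [height_apply] using this
  obtain ⟨-, hu2⟩ := wallPoint_coords (-η₀)
  have hu := hle _ (wallPoint_mem hw₀ hwall (t := -η₀) (by rw [abs_neg, abs_of_pos hη₀]))
  rw [hu2] at hu
  refine ⟨f y₀, hy₀, fun hB => ?_, Or.inr ⟨by linarith, fun p hp hpB => ?_⟩⟩
  · have := hB.2.1; linarith
  · have hpr : p ∈ range f := hUnion ▸ Or.inr hp
    rcases (hle p hpr).lt_or_eq with h | h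
    · exact h
    · exfalso
      obtain ⟨y₁, rfl⟩ := hpr
      have hmin₁ : IsMinOn (height f) univ y₁ := fun y _ => by
        have := hmin (mem_univ y)
        simp only [mem_setOf_eq, height_apply] at this ⊢
        linarith
      have hc₀ : IsMCriticalPt (𝓡 2) (height f) y₀ := IsLocalMin.isMCriticalPt (I := 𝓡 2) (hmin.isLocalMin univ_mem)
      have hc₁ : IsMCriticalPt (𝓡 2) (height f) y₁ := IsLocalMin.isMCriticalPt (I := 𝓡 2) (hmin₁.isLocalMin univ_mem)
      have heq : y₁ = y₀ := hinj hc₁ hc₀ (by rw [height_apply, height_apply, h])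
      rw [heq] at hp
      have : f y₀ ∈ Dup ∩ Dlow := ⟨hy₀, hp⟩
      rw [hInter] at this
      have := this.2
      linarith

end Ext

/-! ### §A2 The sub-configuration -/

section SubConfig

variable {FX : EuclideanSpace ℝ (Fin 3) → ℝ} {P : ℝ → ℝ} {Dup Dlow T₀ : Set (EuclideanSpace ℝ (Fin 3))}
  {w₀ η₀ ε₁ s δ R₁ : ℝ}
  {f : sphere (0 : EuclideanSpace ℝ (Fin 3)) 1 → EuclideanSpace ℝ (Fin 3)}

/-- **The sub-configuration of the step.**  In the normal form `StepNF F_X (D₊ ∪ T₀) D₋` built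
from a configuration `f` in tube normal form (`SchoenfliesStep.exists_stepNF`), with the collar
fill `Φ` and the certification datum `hext`, the sub-sphere `W` bounds a solid presented by a
configuration `(F_B, f_B)` in the sense of `SchoenfliesConfig.Config`, whose zero set is `W`,
which lies inside the filled solid, is positively co-oriented with the sub-sphere function along
`W`, and has the standard lid as a face. [cite: Schultens2014, proof of Thm. 3.2.5 (PDF p. 45)] -/
theorem exists_subConfig (hP : Admissible P) (hN : StepNF FX (Dup ∪ T₀) Dlow w₀ η₀ ε₁)
    (hS : StepScale s δ w₀ η₀)
    (hf : Manifold.IsSmoothEmbedding (𝓡 2) 𝓘(ℝ, EuclideanSpace ℝ (Fin 3)) ∞ f)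
    (hfZ : ∀ y, FX (f y) = 0) (hZ : {x | FX x = 0} = range f ∪ T₀) (hR₁ : 0 < R₁)
    (hT₀far : ∀ x ∈ T₀, R₁ ≤ ‖x‖) (hrangeR : range f ⊆ ball 0 R₁)
    (htubeR : {x | hsq x ≤ (1 + 3 * w₀) ^ 2 ∧ |x 2| ≤ η₀} ⊆ ball 0 R₁)
    (hUnion : Dup ∪ Dlow = range f)
    (hcUp : IsPreconnected (Dup \ {x | hsq x = 1 ∧ x 2 = 0}))
    (hUpMem : ∀ p ∈ range f, hsq p ≤ (1 + 3 * w₀) ^ 2 → |p 2| ≤ η₀ → 0 < p 2 → p ∈ Dup)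
    (hMorse : IsMorse (𝓡 2) (height f))
    (Φ : EuclideanSpace ℝ (Fin 3) ≃ₘ⟮𝓘(ℝ, EuclideanSpace ℝ (Fin 3)),
      𝓘(ℝ, EuclideanSpace ℝ (Fin 3))⟯ EuclideanSpace ℝ (Fin 3))
    (hΦZ : Φ '' {x | FX x = 0} = {x | fillFun FX P s δ ((1 + s) ^ 2 + ε₁ + 2) x = 0})
    (hΦid : ∀ x, x ∉ closedBox s → Φ x = x)
    (hext : ∃ q ∈ Dup, q ∉ closedBox s ∧
      ((s < q 2 ∧ ∀ p ∈ Dlow, p ∉ closedBox s → p 2 < q 2) ∨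
        (q 2 < -(6 * s) ∧ ∀ p ∈ Dlow, p ∉ closedBox s → q 2 < p 2))) :
    ∃ (FB : EuclideanSpace ℝ (Fin 3) → ℝ) (fB : sphere (0 : EuclideanSpace ℝ (Fin 3)) 1 → EuclideanSpace ℝ (Fin 3)),
      Config FB fB ∧ range fB = subSphere FX P (Dup ∪ T₀) s δ ε₁ ∧
      (∀ x, FB x = 0 ↔ x ∈ subSphere FX P (Dup ∪ T₀) s δ ε₁) ∧
      (∀ x, FB x ≤ 0 → fillFun FX P s δ ((1 + s) ^ 2 + ε₁ + 2) x ≤ 0) ∧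
      (∀ x ∈ subSphere FX P (Dup ∪ T₀) s δ ε₁, ∃ μ : ℝ, 0 < μ ∧
        fderiv ℝ FB x = μ • fderiv ℝ (subFun FX P s δ ((1 + s) ^ 2 + ε₁ + 2)) x) ∧
      StdFace FB P s := by
  obtain ⟨hs, hs1, hsw, hsη, -, -⟩ := scales hS
  have hE₂R : Dlow ⊆ ball 0 R₁ := fun x hx => hrangeR (hUnion ▸ Or.inr hx)
  obtain ⟨hΦT, hZ₁, hZ₂, hTW, hTu⟩ :=
    fill_bookkeeping hP hN hS hfZ hZ hT₀far htubeR hE₂R Φ hΦZ hΦid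
  have hfΦ : Manifold.IsSmoothEmbedding (𝓡 2) 𝓘(ℝ, EuclideanSpace ℝ (Fin 3)) ∞ (Φ ∘ f) :=
    hf.diffeomorph_comp Φ
  -- the hypotheses of `exists_subSide` about the kept disc `D₁ = D₊`
  have hwall' : ∀ p, FX p = 0 → p ∈ closedBox s → 0 < p 2 → p ∈ Dup := by
    intro p hp hpB hp2
    have hp' : p ∈ {x | FX x = 0} := hp
    rw [hZ] at hp'
    rcases hp' with hpr | hpT
    · obtain ⟨h1, h2⟩ := closedBox_subset_tube hs hsw hsη hpB
      exact hUpMem p hpr h1 h2 hp2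
    · exfalso
      have := mem_ball_zero_iff.1 (htubeR (closedBox_subset_tube hs hsw hsη hpB))
      linarith [hT₀far p hpT]
  have hfarE₁ : ∀ p ∈ Dup ∪ T₀, p ∉ Dup → R₁ ≤ ‖p‖ := by
    rintro p (hp | hp) hpD
    · exact absurd hp hpD
    · exact hT₀far p hp
  have hWR : ∀ w ∈ subSphere FX P (Dup ∪ T₀) s δ ε₁, ‖w‖ < R₁ := fun w hw =>
    norm_lt_of_mem_subSphere hP hN hS htubeR hE₂R hw
  obtain ⟨FB, fB, hFBs, hprop, hreg, -, hfB, hrange, hrangeW, hpos, hneg, hfill, hco, hface⟩ :=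
    exists_subSide hP hN hS hfΦ (T := T₀) hZ₁ hZ₂ hTW hTu hcUp subset_union_left hwall' hext hR₁ hWR hfarE₁
  have hMorseB : IsMorse (𝓡 2) (height fB) :=
    isMorse_height_sub hP hN hS hf hfZ (fun x hx => hUnion ▸ Or.inr hx) hfB hrangeW hMorse
  refine ⟨FB, fB, ⟨hFBs, hprop, hreg, hfB, hrange, hpos, hneg, hMorseB⟩, hrangeW, fun x => ?_,
    fun x hx => ?_, hco, fun x hx => hface x hx.1 hx.2.1 hx.2.2⟩
  · rw [← hrangeW, hrange]; rfl
  · by_contra h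
    exact absurd hx (not_le.2 (hfill x (not_le.1 h)))

end SubConfig

/-! ### §A3 The orientation test -/

section Test

variable {FX : EuclideanSpace ℝ (Fin 3) → ℝ} {P : ℝ → ℝ} {E₁ E₂ : Set (EuclideanSpace ℝ (Fin 3))}
  {w₀ η₀ ε₁ s δ : ℝ}
  {f fB : sphere (0 : EuclideanSpace ℝ (Fin 3)) 1 → EuclideanSpace ℝ (Fin 3)}

/-- **The orientation test.**  In the normal form of the step, suppose the height of the sphere
`f` is Morse and injective on its critical set, no saddle lies over the absorbed disc `E₂`, and
both a global maximum `y⁺` and a global minimum `y⁻` of the height lie over `E₂` but off `E₁`,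
at heights above `η₀` and below `-η₀`.  Then the sub-sphere `W` (an embedded sphere `f_B` with
range `W`) carries a Morse height with no saddle and three distinct critical points none of
which is a saddle — the apex and the two global extrema — contradicting the Morse count
`#min - #saddle + #max = 2` on `𝕊²`. [cite: Schultens2014, proof of Thm. 3.2.5 (PDF p. 45)] -/
theorem false_of_extrema_over_absorbed (hP : Admissible P) (hN : StepNF FX E₁ E₂ w₀ η₀ ε₁)
    (hS : StepScale s δ w₀ η₀)
    (hf : Manifold.IsSmoothEmbedding (𝓡 2) 𝓘(ℝ, EuclideanSpace ℝ (Fin 3)) ∞ f)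
    (hfZ : ∀ y, FX (f y) = 0) (hE₂ : E₂ ⊆ range f)
    (hfB : Manifold.IsSmoothEmbedding (𝓡 2) 𝓘(ℝ, EuclideanSpace ℝ (Fin 3)) ∞ fB)
    (hWB : range fB = subSphere FX P E₁ s δ ε₁)
    (hMorse : IsMorse (𝓡 2) (height f))
    (hnos : ∀ y' ∈ criticalSetOfIndex (𝓡 2) (height f) 1, f y' ∉ E₂)
    {yM ym : sphere (0 : EuclideanSpace ℝ (Fin 3)) 1}
    (hM : IsMaxOn (height f) univ yM) (hMmem : f yM ∈ E₂) (hMη : η₀ ≤ height f yM)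
    (hm : IsMinOn (height f) univ ym) (hmmem : f ym ∈ E₂) (hmη : height f ym ≤ -η₀) : False := by
  obtain ⟨hs, hs1, hsw, hsη, -, -⟩ := scales hS
  have hMorseB : IsMorse (𝓡 2) (height fB) := isMorse_height_sub hP hN hS hf hfZ hE₂ hfB hWB hMorse
  -- no saddle on the sub-sphere
  have hS1 : criticalSetOfIndex (𝓡 2) (height fB) 1 = ∅ := by
    have himg := image_saddles_sub hP hN hS hf hfZ hE₂ hfB hWB hMorse
    have hempty : f '' {y' | y' ∈ criticalSetOfIndex (𝓡 2) (height f) 1 ∧ f y' ∈ E₂} = ∅ := by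
      rw [image_eq_empty]; ext y'; simp only [mem_setOf_eq, mem_empty_iff_false, iff_false, not_and]
      exact hnos y'
    rw [hempty, image_eq_empty] at himg
    exact himg
  -- critical points of the original height lie off the closed box
  have hcM : IsMCriticalPt (𝓡 2) (height f) yM := IsLocalMax.isMCriticalPt (I := 𝓡 2) (hM.isLocalMax univ_mem)
  have hcm : IsMCriticalPt (𝓡 2) (height f) ym := IsLocalMin.isMCriticalPt (I := 𝓡 2) (hm.isLocalMin univ_mem)
  have hMB : f yM ∉ closedBox s := not_mem_closedBox_of_isMCriticalPt hN hS hf hfZ hcM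
  have hmB : f ym ∉ closedBox s := not_mem_closedBox_of_isMCriticalPt hN hS hf hfZ hcm
  -- the three critical points of the sub-sphere: apex, maximum, minimum
  have hWsub : E₂ \ closedBox s ⊆ subSphere FX P E₁ s δ ε₁ := by
    rw [subSphere_eq hP hN hS]; exact subset_union_right
  obtain ⟨zM, hzM⟩ : f yM ∈ range fB := by rw [hWB]; exact hWsub ⟨hMmem, hMB⟩
  obtain ⟨zm, hzm⟩ : f ym ∈ range fB := by rw [hWB]; exact hWsub ⟨hmmem, hmB⟩
  obtain ⟨za, hza⟩ : s • EuclideanSpace.single (2 : Fin 3) (1 : ℝ) ∈ range fB := by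
    rw [hWB]; exact (apex_mem hP hN hS (x := s • EuclideanSpace.single (2 : Fin 3) (1 : ℝ))
      (by simp) (by simp) (by simp)).1
  have hiff := isMCriticalPt_sub_iff hP hN hS hf hfZ hE₂ hfB hWB
  have hczM : IsMCriticalPt (𝓡 2) (height fB) zM :=
    (hiff zM).2 (Or.inr ⟨yM, hzM.symm, hMmem, hMB, hcM⟩)
  have hczm : IsMCriticalPt (𝓡 2) (height fB) zm :=
    (hiff zm).2 (Or.inr ⟨ym, hzm.symm, hmmem, hmB, hcm⟩)
  have hcza : IsMCriticalPt (𝓡 2) (height fB) za :=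
    (hiff za).2 (Or.inl ⟨by rw [hza]; simp, by rw [hza]; simp, by rw [hza]; simp⟩)
  -- their heights are `≥ η₀`, `≤ -η₀`, `= s`: pairwise distinct
  have hhM : height fB zM = height f yM := by rw [height_apply, height_apply, hzM]
  have hhm : height fB zm = height f ym := by rw [height_apply, height_apply, hzm]
  have hha : height fB za = s := by rw [height_apply, hza]; simp
  have hη₀ : 0 < η₀ := by linarith
  have hne1 : zM ≠ zm := fun h => by have := congrArg (height fB) h; rw [hhM, hhm] at this; linarith
  have hne2 : zM ≠ za := fun h => by have := congrArg (height fB) h; rw [hhM, hha] at this; linarith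
  have hne3 : zm ≠ za := fun h => by have := congrArg (height fB) h; rw [hhm, hha] at this; linarith
  -- none is a saddle, so each has index `0` or `2`
  have hidx : ∀ z, IsMCriticalPt (𝓡 2) (height fB) z →
      z ∈ criticalSetOfIndex (𝓡 2) (height fB) 0 ∪ criticalSetOfIndex (𝓡 2) (height fB) 2 := by
    intro z hz
    have hle : morseIndex (𝓡 2) (height fB) z ≤ 2 := by
      have := morseIndex_le_finrank (𝓡 2) (height fB) z
      simpa [finrank_euclideanSpace_fin] using this
    have hne : morseIndex (𝓡 2) (height fB) z ≠ 1 := fun h1 => by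
      have : z ∈ criticalSetOfIndex (𝓡 2) (height fB) 1 := ⟨hz, h1⟩
      rw [hS1] at this; exact this
    rcases Nat.lt_or_ge (morseIndex (𝓡 2) (height fB) z) 1 with h | h
    · exact Or.inl ⟨hz, by omega⟩
    · exact Or.inr ⟨hz, by omega⟩
  -- the Morse count: `#index 0 + #index 2 = 2`, but the union has at least three elements
  have hcount := SphereMorseCount.morseCount_sphere_two hMorseB
  rw [hS1, ncard_empty, Nat.cast_zero, sub_zero] at hcount
  have hfin : (criticalSet (𝓡 2) (height fB)).Finite := IsMorse.finite_criticalSet_holds hMorseB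
  have hfin0 : (criticalSetOfIndex (𝓡 2) (height fB) 0).Finite :=
    hfin.subset (criticalSetOfIndex_subset _ _ _)
  have hfin2 : (criticalSetOfIndex (𝓡 2) (height fB) 2).Finite :=
    hfin.subset (criticalSetOfIndex_subset _ _ _)
  have hdisj : Disjoint (criticalSetOfIndex (𝓡 2) (height fB) 0) (criticalSetOfIndex (𝓡 2) (height fB) 2) := by
    rw [Set.disjoint_left]
    rintro z ⟨-, h0⟩ ⟨-, h2⟩; rw [h0] at h2; exact absurd h2 (by norm_num)
  have hunion := Set.ncard_union_eq hdisj hfin0 hfin2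
  have hthree : ({zM, zm, za} : Set (sphere (0 : EuclideanSpace ℝ (Fin 3)) 1)) ⊆
      criticalSetOfIndex (𝓡 2) (height fB) 0 ∪ criticalSetOfIndex (𝓡 2) (height fB) 2 := by
    intro z hz
    simp only [mem_insert_iff, mem_singleton_iff] at hz
    rcases hz with rfl | rfl | rfl
    · exact hidx _ hczM
    · exact hidx _ hczm
    · exact hidx _ hcza
  have h3 : ({zM, zm, za} : Set (sphere (0 : EuclideanSpace ℝ (Fin 3)) 1)).ncard = 3 := by
    rw [ncard_insert_of_notMem (by simp [hne1, hne2]) (toFinite _),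
      ncard_insert_of_notMem (by simp [hne3]) (toFinite _), ncard_singleton]
  have hle := ncard_le_ncard hthree (hfin0.union hfin2)
  rw [h3, hunion] at hle
  omega

end Test

open CappedBallLid SchoenfliesConfig SweepFace

/-! ## Part B — the sweep and the swept configuration -/

/-! ### §B1 Embedded spheres with Morse height are configurations -/

/-- **An embedded sphere with Morse height is a configuration.**  The Jordan–Brouwer side
function of `AlexanderTools.exists_euclidean_sideFunction_connected` (zero set the sphere,
regular there, compact inside, connected open sides), modified far away into a proper one
(`SideComparison.exists_properPos`), presents `f` as a `SchoenfliesConfig.Config`.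
[cite: Schultens2014, proof of Thm. 3.2.5 (PDF p. 43)] -/
theorem exists_config_of_isMorse
    {f : sphere (0 : EuclideanSpace ℝ (Fin 3)) 1 → EuclideanSpace ℝ (Fin 3)}
    (hf : Manifold.IsSmoothEmbedding (𝓡 2) 𝓘(ℝ, EuclideanSpace ℝ (Fin 3)) ∞ f)
    (hMorse : IsMorse (𝓡 2) (height f)) :
    ∃ F : EuclideanSpace ℝ (Fin 3) → ℝ, Config F f := by
  obtain ⟨F, hFs, hFZ, hFreg, hK, -, hneg, hpos⟩ :=
    AlexanderTools.exists_euclidean_sideFunction_connected (m := 2) (by norm_num) hf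
  obtain ⟨F', hF's, hprop, hlt, heq, hgt, R, hR, hKR, hFF'⟩ := SideComparison.exists_properPos hFs hK
  refine ⟨F', hF's, hprop, fun x hx => ?_, hf, ?_, ?_, ?_, hMorse⟩
  · -- regular: `F' = F` near the zero set
    have hx0 : F x = 0 := (heq x).1 hx
    have hxR : x ∈ ball (0 : EuclideanSpace ℝ (Fin 3)) R := hKR (show F x ≤ 0 by rw [hx0])
    have hev : F' =ᶠ[𝓝 x] F := by
      filter_upwards [isOpen_ball.mem_nhds hxR] with y hy using hFF' y hy
    rw [hev.fderiv_eq]; exact hFreg x hx0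
  · ext x; rw [mem_setOf_eq, heq x]; exact (hFZ x).symm
  · have : {x | 0 < F' x} = {x | 0 < F x} := by ext x; exact hgt x
    rw [this]; exact hpos
  · have : {x | F' x < 0} = {x | F x < 0} := by ext x; exact hlt x
    rw [this]; exact hneg

/-! ### §B2 The ball parametrisation from the induction hypothesis -/

/-- **The induction hypothesis in the form consumed by the sweep.**  If the sub-sphere
`f_B(𝕊²) = {F_B = 0}` of a configuration `(F_B, f_B)` is the image of the unit sphere under a
smooth embedding `e_B : ℝ³ → ℝ³`, then some diffeomorphism `Φ_B` of `ℝ³` carries the closed unit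
ball onto `{F_B ≤ 0}`, the unit sphere onto `{F_B = 0}` and the open ball onto `{F_B < 0}`.
[cite: Schultens2014, proof of Thm. 3.2.5 (PDF p. 45)] -/
theorem exists_ballParam {FB : EuclideanSpace ℝ (Fin 3) → ℝ}
    {fB : sphere (0 : EuclideanSpace ℝ (Fin 3)) 1 → EuclideanSpace ℝ (Fin 3)} (hC : Config FB fB)
    {eB : EuclideanSpace ℝ (Fin 3) → EuclideanSpace ℝ (Fin 3)}
    (heB : Manifold.IsSmoothEmbedding 𝓘(ℝ, EuclideanSpace ℝ (Fin 3)) 𝓘(ℝ, EuclideanSpace ℝ (Fin 3)) ∞ eB)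
    (heBS : eB '' sphere 0 1 = range fB) :
    ∃ ΦB : EuclideanSpace ℝ (Fin 3) ≃ₘ⟮𝓘(ℝ, EuclideanSpace ℝ (Fin 3)), 𝓘(ℝ, EuclideanSpace ℝ (Fin 3))⟯
        EuclideanSpace ℝ (Fin 3),
      ΦB '' closedBall 0 1 = {x | FB x ≤ 0} ∧ ΦB '' sphere 0 1 = {x | FB x = 0} ∧
      ΦB '' ball 0 1 = {x | FB x < 0} := by
  obtain ⟨ε, hε, hKε⟩ := hC.proper
  have hK : IsCompact {x | FB x ≤ 0} :=
    hKε.of_isClosed_subset (isClosed_le hC.smooth.continuous continuous_const)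
      (fun x (hx : FB x ≤ 0) => show FB x ≤ ε by linarith)
  have hZ : eB '' sphere 0 1 = {x | FB x = 0} := by rw [heBS, hC.range_eq]
  have hD := AlexanderTools.image_closedBall_eq_setOf_nonpos (k := 3) (by norm_num) heB
    hC.smooth.continuous hK hZ hC.conn_pos hC.conn_neg
  have hO := AlexanderTools.image_ball_eq_setOf_neg (k := 3) (by norm_num) heB
    hC.smooth.continuous hK hZ hC.conn_pos hC.conn_neg
  obtain ⟨ΦB, -, h1, h2, h3⟩ := BallFaceAlignment.exists_diffeomorph_image_closedBall_eq (m := 3)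
    (by norm_num) heB
  exact ⟨ΦB, by rw [h1, hD], by rw [h2, hZ], by rw [h3, hO]⟩

/-! ### §B3 The swept configuration -/

section Swept

variable {FX : EuclideanSpace ℝ (Fin 3) → ℝ} {P : ℝ → ℝ} {Dup Dlow T₀ : Set (EuclideanSpace ℝ (Fin 3))}
  {w₀ η₀ ε₁ s δ R₁ : ℝ}
  {f : sphere (0 : EuclideanSpace ℝ (Fin 3)) 1 → EuclideanSpace ℝ (Fin 3)}
  {FB : EuclideanSpace ℝ (Fin 3) → ℝ}
  {fB : sphere (0 : EuclideanSpace ℝ (Fin 3)) 1 → EuclideanSpace ℝ (Fin 3)}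

/-- The first derivative of the bowl germ `x ↦ (z_b(x) - x₂)/s`, `z_b = 3s/8 + (s/8)ρ²`:
`s⁻¹ ((s/8) dρ² - dx₂)`. [folklore] -/
theorem hasFDerivAt_bowlGerm (s : ℝ) (x : EuclideanSpace ℝ (Fin 3)) :
    HasFDerivAt (fun y : EuclideanSpace ℝ (Fin 3) => (bowl s (s / 8) y - y 2) / s)
      (s⁻¹ • ((s / 8) • dhsqL x - dz)) x := by
  have hb : HasFDerivAt (bowl s (s / 8)) ((s / 8) • dhsqL x) x := by
    have := ((hasFDerivAt_hsq x).const_smul (s / 8)).const_add (s / 2 - s / 8)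
    rw [dhsq_eq_dhsqL] at this
    refine this.congr_of_eventuallyEq (Filter.Eventually.of_forall fun z => ?_)
    simp [bowl, smul_eq_mul]
  have h := (hb.fun_sub (hasFDerivAt_coord_two x)).mul_const s⁻¹
  refine h.congr_of_eventuallyEq (Filter.Eventually.of_forall fun z => ?_)
  simp [div_eq_mul_inv]

/-- The second derivative of the bowl germ is `(8)⁻¹ D²ρ²`, i.e. `(w, w') ↦ (w₀ w₀' + w₁ w₁')/4`
(for `s ≠ 0`). [folklore] -/
theorem fderiv_fderiv_bowlGerm {s : ℝ} (hs : s ≠ 0) (x w w' : EuclideanSpace ℝ (Fin 3)) :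
    fderiv ℝ (fderiv ℝ (fun y : EuclideanSpace ℝ (Fin 3) => (bowl s (s / 8) y - y 2) / s)) x w w' =
      (w 0 * w' 0 + w 1 * w' 1) / 4 := by
  have h1 : fderiv ℝ (fun y : EuclideanSpace ℝ (Fin 3) => (bowl s (s / 8) y - y 2) / s) =
      fun y => s⁻¹ • ((s / 8) • dhsqL y - dz) := funext fun y => (hasFDerivAt_bowlGerm s y).fderiv
  rw [h1]
  have h2 : HasFDerivAt (fun y : EuclideanSpace ℝ (Fin 3) => s⁻¹ • ((s / 8) • dhsqL y - dz))
      (s⁻¹ • ((s / 8) • dhsqL)) x :=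
    (((dhsqL.hasFDerivAt (x := x)).const_smul (s / 8)).sub_const dz).const_smul s⁻¹
  rw [h2.fderiv]
  simp only [FunLike.coe_smul, Pi.smul_apply, dhsqL_apply_apply, smul_eq_mul]
  field_simp
  ring

/-- A bijection of a type which is the identity off a set `B` preserves membership in `B`.
[folklore] -/
theorem mem_iff_of_apply_eq_self_of_not_mem {X : Type*} {B : Set X} {Φ : X → X} (hinj : Injective Φ)
    (hid : ∀ x, x ∉ B → Φ x = x) (z : X) : Φ z ∈ B ↔ z ∈ B := by
  constructor
  · intro h
    by_contra hz
    rw [hid z hz] at h; exact hz h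
  · intro hz
    by_contra h
    have : Φ (Φ z) = Φ z := hid _ h
    exact h (by rw [hinj this]; exact hz)

variable (hP : Admissible P) (hN : StepNF FX (Dup ∪ T₀) Dlow w₀ η₀ ε₁) (hS : StepScale s δ w₀ η₀)
  (hδε : δ < ε₁)
  (hf : Manifold.IsSmoothEmbedding (𝓡 2) 𝓘(ℝ, EuclideanSpace ℝ (Fin 3)) ∞ f)
  (hfZ : ∀ y, FX (f y) = 0) (hZ : {x | FX x = 0} = range f ∪ T₀)
  (hT₀far : ∀ x ∈ T₀, R₁ ≤ ‖x‖) (hT₀range : ∀ x ∈ T₀, x ∉ range f)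
  (hrangeR : range f ⊆ ball 0 R₁)
  (htubeR : {x | hsq x ≤ (1 + 3 * w₀) ^ 2 ∧ |x 2| ≤ η₀} ⊆ ball 0 R₁)
  (hUnion : Dup ∪ Dlow = range f)
  (hMorse : IsMorse (𝓡 2) (height f))
  (Φ : EuclideanSpace ℝ (Fin 3) ≃ₘ⟮𝓘(ℝ, EuclideanSpace ℝ (Fin 3)),
    𝓘(ℝ, EuclideanSpace ℝ (Fin 3))⟯ EuclideanSpace ℝ (Fin 3))
  (hΦZ : Φ '' {x | FX x = 0} = {x | fillFun FX P s δ ((1 + s) ^ 2 + ε₁ + 2) x = 0})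
  (hΦid : ∀ x, x ∉ closedBox s → Φ x = x)
  (hCB : Config FB fB) (hrangeW : range fB = subSphere FX P (Dup ∪ T₀) s δ ε₁)
  (hBsub : ∀ x, FB x ≤ 0 → fillFun FX P s δ ((1 + s) ^ 2 + ε₁ + 2) x ≤ 0)
  (hco : ∀ x ∈ subSphere FX P (Dup ∪ T₀) s δ ε₁, ∃ μ : ℝ, 0 < μ ∧
    fderiv ℝ FB x = μ • fderiv ℝ (subFun FX P s δ ((1 + s) ^ 2 + ε₁ + 2)) x)
  (hface : StdFace FB P s)
  {eB : EuclideanSpace ℝ (Fin 3) → EuclideanSpace ℝ (Fin 3)}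
  (heB : Manifold.IsSmoothEmbedding 𝓘(ℝ, EuclideanSpace ℝ (Fin 3)) 𝓘(ℝ, EuclideanSpace ℝ (Fin 3)) ∞ eB)
  (heBS : eB '' sphere 0 1 = range fB)
include hP hN hS hδε hf hfZ hZ hT₀far hT₀range hrangeR htubeR hUnion hMorse hΦZ hΦid hCB hrangeW hBsub hco
  hface heB heBS

set_option maxHeartbeats 1600000 in
/-- **The swept sphere** (see the module docstring): absorbing the ball bounded by the
sub-sphere through the lid (`SweepDriver.exists_sweepStep`) turns the filled embedding
`Φ_c ∘ f` into a smooth embedding `f_U = Θ ∘ f` whose Morse data are those of `f` away from the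
absorbed disc `D₋`, plus the bowl centre. [cite: Schultens2014, proof of Thm. 3.2.5 (PDF p. 45)] -/
theorem exists_swept :
    ∃ (Θ : EuclideanSpace ℝ (Fin 3) ≃ₘ⟮𝓘(ℝ, EuclideanSpace ℝ (Fin 3)), 𝓘(ℝ, EuclideanSpace ℝ (Fin 3))⟯
        EuclideanSpace ℝ (Fin 3)) (FU : EuclideanSpace ℝ (Fin 3) → ℝ),
      ContDiff ℝ ∞ FU ∧ (∀ y, FU (Θ (f y)) = 0) ∧ (∀ x, FU x = 0 → fderiv ℝ FU x ≠ 0) ∧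
      IsMorse (𝓡 2) (height (Θ ∘ f)) ∧
      -- critical points: the old ones off the absorbed disc (same point, same germ) or the bowl centre
      (∀ y, IsMCriticalPt (𝓡 2) (height (Θ ∘ f)) y →
        (IsMCriticalPt (𝓡 2) (height f) y ∧ f y ∉ Dlow ∧ Θ (f y) = f y ∧
            height (Θ ∘ f) =ᶠ[𝓝 y] height f) ∨
          (Θ (f y) = EuclideanSpace.single (2 : Fin 3) (3 * s / 8) ∧ height (Θ ∘ f) y = 3 * s / 8 ∧
            morseIndex (𝓡 2) (height (Θ ∘ f)) y ≠ 1)) ∧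
      (∀ y, IsMCriticalPt (𝓡 2) (height f) y → f y ∉ Dlow →
        Θ (f y) = f y ∧ height (Θ ∘ f) =ᶠ[𝓝 y] height f) ∧
      criticalSetOfIndex (𝓡 2) (height (Θ ∘ f)) 1 =
        {y | y ∈ criticalSetOfIndex (𝓡 2) (height f) 1 ∧ f y ∉ Dlow} ∧
      range (Θ ∘ f) ∩ {x | x 2 = 0} = (range f ∩ {x | x 2 = 0}) \ (closedBox s ∪ Dlow) := by
  obtain ⟨hs, hs1, hsw, hsη, hδ, hδs⟩ := scales hS
  obtain ⟨pc, hpc⟩ : ∃ pc : EuclideanSpace ℝ (Fin 3), pc = EuclideanSpace.single (2 : Fin 3) (3 * s / 8) := ⟨_, rfl⟩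
  have hE₂R : Dlow ⊆ ball 0 R₁ := fun x hx => hrangeR (hUnion ▸ Or.inr hx)
  obtain ⟨hΦT, hZ₁, hZ₂, hTW, -⟩ := fill_bookkeeping hP hN hS hfZ hZ hT₀far htubeR hE₂R Φ hΦZ hΦid
  have hΦbox : ∀ z, Φ z ∈ closedBox s ↔ z ∈ closedBox s :=
    mem_iff_of_apply_eq_self_of_not_mem Φ.injective hΦid
  -- the ball parametrisation and the sweep
  obtain ⟨ΦB, hΦBD, hΦBS, hΦBo⟩ := exists_ballParam hCB heB heBS
  have hFBW : ∀ x, FB x = 0 ↔ x ∈ subSphere FX P (Dup ∪ T₀) s δ ε₁ := fun x => by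
    rw [← hrangeW, hCB.range_eq]; rfl
  have hK₁ : IsCompact {x | fillFun FX P s δ ((1 + s) ^ 2 + ε₁ + 2) x ≤ ε₁ - δ} :=
    isCompact_setOf_fillFun_le hP.hP hP.hPle hP.hPge hN.hF hs hδ hN.hKε (by linarith)
  obtain ⟨FU, Φsw, hFUs, himg, himg0, hregU, -, hfar, hhor, hpc0, hpcgerm, hlevel⟩ :=
    SweepDriver.exists_sweepStep hP hN hS hCB.smooth hFBW hCB.reg hBsub hco hface ΦB hΦBD hΦBS hΦBo
      (show 0 < ε₁ - δ by linarith) hK₁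
  rw [← hpc] at hhor hpc0 hpcgerm
  -- the swept embedding `Θ ∘ f`, `Θ = Φsw ∘ Φ`
  refine ⟨Φ.trans Φsw, FU, hFUs, ?_⟩
  have hΘapply : ∀ x, (Φ.trans Φsw) x = Φsw (Φ x) := fun x => rfl
  have hfU : Manifold.IsSmoothEmbedding (𝓡 2) 𝓘(ℝ, EuclideanSpace ℝ (Fin 3)) ∞ ((Φ.trans Φsw) ∘ f) :=
    hf.diffeomorph_comp (Φ.trans Φsw)
  have hZU : ∀ y, FU ((Φ.trans Φsw) (f y)) = 0 := fun y => by
    have : Φsw (Φ (f y)) ∈ Φsw '' {x | fillFun FX P s δ ((1 + s) ^ 2 + ε₁ + 2) x = 0} := ⟨Φ (f y), hZ₁ y, rfl⟩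
    rw [himg0] at this; exact this
  -- far critical points: `Θ = id` and `F_U = F₂ = F_X` nearby
  have hfarpt : ∀ y, IsMCriticalPt (𝓡 2) (height f) y → f y ∉ Dlow →
      (∀ᶠ x in 𝓝 (f y), Φsw x = x) ∧ FU =ᶠ[𝓝 (f y)] fillFun FX P s δ ((1 + s) ^ 2 + ε₁ + 2) ∧
        fillFun FX P s δ ((1 + s) ^ 2 + ε₁ + 2) =ᶠ[𝓝 (f y)] FX ∧ (∀ᶠ x in 𝓝 (f y), Φ x = x) := by
    intro y hy hyD
    have hB : f y ∉ closedBox s := not_mem_closedBox_of_isMCriticalPt hN hS hf hfZ hy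
    have hΦy : Φ (f y) = f y := hΦid _ hB
    have hF₂y : fillFun FX P s δ ((1 + s) ^ 2 + ε₁ + 2) (f y) = 0 := by have := hZ₁ y; rwa [hΦy] at this
    obtain ⟨h1, h2⟩ := hfar (f y) hF₂y hB hyD
    refine ⟨h1, h2, fillFun_eventuallyEq_of_not_mem hP hN hS hB (by rw [hfZ y]; norm_num), ?_⟩
    filter_upwards [isClosed_closedBox.isOpen_compl.mem_nhds hB] with x hx using hΦid x hx
  have hΘfix : ∀ y, IsMCriticalPt (𝓡 2) (height f) y → f y ∉ Dlow → (Φ.trans Φsw) (f y) = f y := by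
    intro y hy hyD
    obtain ⟨h1, -, -, h4⟩ := hfarpt y hy hyD
    rw [hΘapply, h4.self_of_nhds, h1.self_of_nhds]
  have hΘgerm : ∀ y, IsMCriticalPt (𝓡 2) (height f) y → f y ∉ Dlow →
      height ((Φ.trans Φsw) ∘ f) =ᶠ[𝓝 y] height f := by
    intro y hy hyD
    obtain ⟨h1, -, -, h4⟩ := hfarpt y hy hyD
    have hc : ContinuousAt f y := hf.contMDiff.continuous.continuousAt
    have h4' : ∀ᶠ z in 𝓝 y, Φ (f z) = f z := hc.eventually h4
    have h1' : ∀ᶠ z in 𝓝 y, Φsw (f z) = f z := hc.eventually h1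
    filter_upwards [h4', h1'] with z hz4 hz1
    simp only [height_apply, Function.comp_apply, hΘapply, hz4, hz1]
  -- the dictionary for the swept sphere
  have hdim : Module.finrank ℝ (EuclideanSpace ℝ (Fin 3)) = 2 + 1 := by simp
  have hdim3 : Module.finrank ℝ (EuclideanSpace ℝ (Fin 3)) = 3 := by simp
  have hinjf := fun x => injective_mfderiv_of_isImmersionAt' (hf.isImmersion.isImmersionAt x)
  have hinjU := fun x => injective_mfderiv_of_isImmersionAt' (hfU.isImmersion.isImmersionAt x)
  have hregf : ∀ y, fderiv ℝ FX (f y) ≠ 0 := fun y => hN.hreg _ (hfZ y)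
  have hregfU : ∀ y, fderiv ℝ FU (((Φ.trans Φsw) ∘ f) y) ≠ 0 := fun y => hregU _ (hZU y)
  have hcritU := HeightDictionary.criticalSet_inner_comp_eq_preimage (M := sphere (0 : EuclideanSpace ℝ (Fin 3)) 1)
    hdim (f := (Φ.trans Φsw) ∘ f) (fun x => (hfU.contMDiff.mdifferentiableAt (by simp))) hinjU
    (F := FU) (fun x => (hFUs.differentiable (by simp)) _) hZU hregfU e₂_ne_zero
  have hcrit := HeightDictionary.criticalSet_inner_comp_eq_preimage (M := sphere (0 : EuclideanSpace ℝ (Fin 3)) 1)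
    hdim (f := f) (fun x => (hf.contMDiff.mdifferentiableAt (by simp))) hinjf
    (F := FX) (fun x => (hN.hF.differentiable (by simp)) _) hfZ hregf e₂_ne_zero
  have hcU : ∀ z, IsMCriticalPt (𝓡 2) (height ((Φ.trans Φsw) ∘ f)) z ↔
      ∃ c : ℝ, fderiv ℝ FU ((Φ.trans Φsw) (f z)) = c • innerSL ℝ (EuclideanSpace.single (2 : Fin 3) (1 : ℝ)) :=
    fun z => by rw [height_eq]; exact Set.ext_iff.1 hcritU z
  have hc : ∀ z, IsMCriticalPt (𝓡 2) (height f) z ↔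
      ∃ c : ℝ, fderiv ℝ FX (f z) = c • innerSL ℝ (EuclideanSpace.single (2 : Fin 3) (1 : ℝ)) :=
    fun z => by rw [height_eq]; exact Set.ext_iff.1 hcrit z
  have hdz : (dz : EuclideanSpace ℝ (Fin 3) →L[ℝ] ℝ) = innerSL ℝ (EuclideanSpace.single (2 : Fin 3) (1 : ℝ)) := by
    ext v; simp [dz_apply, EuclideanSpace.inner_single_left]
  -- classification of the critical points of the swept height
  have hclass : ∀ y, IsMCriticalPt (𝓡 2) (height ((Φ.trans Φsw) ∘ f)) y →
      (IsMCriticalPt (𝓡 2) (height f) y ∧ f y ∉ Dlow ∧ (Φ.trans Φsw) (f y) = f y) ∨ (Φ.trans Φsw) (f y) = pc := by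
    intro y hy
    obtain ⟨c, hc'⟩ := (hcU y).1 hy
    rcases hhor ((Φ.trans Φsw) (f y)) (hZU y) ⟨c, by rw [hdz]; exact hc'⟩ with ⟨hF₂0, hB, hD, hgerm⟩ | h
    · left
      obtain ⟨h1, -⟩ := hfar _ hF₂0 hB hD
      have hΦsw : Φsw ((Φ.trans Φsw) (f y)) = (Φ.trans Φsw) (f y) := h1.self_of_nhds
      -- `Θ (f y)` is not on `T₀`: `Θ` fixes `T₀` pointwise
      have hnotT : (Φ.trans Φsw) (f y) ∉ T₀ := fun hT => by
        have hfix : (Φ.trans Φsw) ((Φ.trans Φsw) (f y)) = (Φ.trans Φsw) (f y) := by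
          rw [hΘapply ((Φ.trans Φsw) (f y)), hΦT _ hT]; exact hΦsw
        have heq : (Φ.trans Φsw) (f y) = f y := (Φ.trans Φsw).injective hfix
        exact hT₀range _ hT ⟨y, heq.symm⟩
      -- hence on the filled sphere: `Φ (f y') = Θ (f y)` for some `y'`, and then `y' = y`
      obtain ⟨y', hy'⟩ := hZ₂ _ hF₂0 hnotT
      have hy'' : Φ (f y') = (Φ.trans Φsw) (f y) := hy'
      have hyy : (Φ.trans Φsw) (f y') = (Φ.trans Φsw) (f y) := by rw [hΘapply, hy'', hΦsw]
      have hyeq : y' = y := hfU.isEmbedding.injective hyy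
      rw [hyeq] at hy''
      -- `Φ (f y) = Θ (f y)` is off the box, so `f y` is off the box and `Φ (f y) = f y`
      have hfyB : f y ∉ closedBox s := fun h' => hB (hy'' ▸ (hΦbox (f y)).2 h')
      have hΘfy : (Φ.trans Φsw) (f y) = f y := by rw [← hy'', hΦid _ hfyB]
      refine ⟨(hc y).2 ?_, hΘfy ▸ hD, hΘfy⟩
      -- horizontality transfers along the germs `F_U = F₂ = F_X` near `f y`
      rw [hΘfy] at hgerm hc'
      have hgermX : fillFun FX P s δ ((1 + s) ^ 2 + ε₁ + 2) =ᶠ[𝓝 (f y)] FX :=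
        fillFun_eventuallyEq_of_not_mem hP hN hS hfyB (by rw [hfZ y]; norm_num)
      have hD1 : fderiv ℝ FU (f y) = fderiv ℝ FX (f y) := by rw [hgerm.fderiv_eq, hgermX.fderiv_eq]
      exact ⟨c, by rw [← hD1]; exact hc'⟩
    · exact Or.inr h
  -- at the bowl centre: value, derivatives, not a saddle
  have hpc0' : pc 0 = 0 := by rw [hpc]; simp
  have hpc1' : pc 1 = 0 := by rw [hpc]; simp
  have hpc2 : pc 2 = 3 * s / 8 := by rw [hpc]; simp
  have hpcval : ∀ y, (Φ.trans Φsw) (f y) = pc → height ((Φ.trans Φsw) ∘ f) y = 3 * s / 8 := fun y hy => by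
    rw [height_apply, Function.comp_apply, hy, hpc2]
  have hD1pc : fderiv ℝ FU pc = (-s⁻¹) • innerSL ℝ (EuclideanSpace.single (2 : Fin 3) (1 : ℝ)) := by
    rw [hpcgerm.fderiv_eq, (hasFDerivAt_bowlGerm s pc).fderiv, ← hdz]
    ext v
    simp [dhsqL_apply_apply, hpc0', hpc1', dz_apply]
  have hD2pc : ∀ w w', fderiv ℝ (fderiv ℝ FU) pc w w' = (w 0 * w' 0 + w 1 * w' 1) / 4 := by
    intro w w'
    rw [hpcgerm.fderiv.fderiv_eq]
    exact fderiv_fderiv_bowlGerm hs.ne' pc w w'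
  have hsepU : ∀ x (c : ℝ), fderiv ℝ FU (((Φ.trans Φsw) ∘ f) x) = c • innerSL ℝ (EuclideanSpace.single (2 : Fin 3) (1 : ℝ)) →
      ∀ w, ⟪EuclideanSpace.single (2 : Fin 3) (1 : ℝ), w⟫ = 0 →
        (∀ w', ⟪EuclideanSpace.single (2 : Fin 3) (1 : ℝ), w'⟫ = 0 →
          fderiv ℝ (fderiv ℝ FU) (((Φ.trans Φsw) ∘ f) x) w w' = 0) → w = 0 := by
    have hsepF := (HeightDictionary.isMorse_inner_comp_iff hdim hf.contMDiff hinjf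
      (hN.hF.of_le (by norm_cast)) hfZ hregf e₂_ne_zero).1 hMorse
    intro x c hcx w hw hker
    rcases hclass x ((hcU x).2 ⟨c, hcx⟩) with ⟨hxc, hxD, hΘx⟩ | hΘx
    · obtain ⟨-, hgerm, hgermX, -⟩ := hfarpt x hxc hxD
      have hD2 : fderiv ℝ (fderiv ℝ FU) (f x) = fderiv ℝ (fderiv ℝ FX) (f x) := by
        rw [hgerm.fderiv.fderiv_eq, hgermX.fderiv.fderiv_eq]
      have hD1 : fderiv ℝ FU (f x) = fderiv ℝ FX (f x) := by rw [hgerm.fderiv_eq, hgermX.fderiv_eq]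
      have hΘx' : ((Φ.trans Φsw) ∘ f) x = f x := hΘx
      rw [hΘx'] at hcx hker
      refine hsepF x c (by rw [← hD1]; exact hcx) w hw fun w' hw' => ?_
      rw [← hD2]; exact hker w' hw'
    · have hΘx' : ((Φ.trans Φsw) ∘ f) x = pc := hΘx
      rw [hΘx'] at hker
      have h := hker w hw
      rw [hD2pc] at h
      have hw2 : w 2 = 0 := by simpa [EuclideanSpace.inner_single_left] using hw
      have h0 : w 0 * w 0 + w 1 * w 1 = 0 := by linarith
      have hw0 : w 0 = 0 := by nlinarith [sq_nonneg (w 0), sq_nonneg (w 1)]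
      have hw1 : w 1 = 0 := by nlinarith [sq_nonneg (w 0), sq_nonneg (w 1)]
      ext i; fin_cases i <;> simp [hw0, hw1, hw2]
  have hMorseU : IsMorse (𝓡 2) (height ((Φ.trans Φsw) ∘ f)) := by
    rw [height_eq]
    exact (HeightDictionary.isMorse_inner_comp_iff hdim hfU.contMDiff hinjU
      (hFUs.of_le (by norm_cast)) hZU hregfU e₂_ne_zero).2 hsepU
  have hidxpc : ∀ y, (Φ.trans Φsw) (f y) = pc → morseIndex (𝓡 2) (height ((Φ.trans Φsw) ∘ f)) y ≠ 1 := by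
    intro y hy h1
    have hy' : ((Φ.trans Φsw) ∘ f) y = pc := hy
    have hcy : fderiv ℝ FU (((Φ.trans Φsw) ∘ f) y) = (-s⁻¹) • innerSL ℝ (EuclideanSpace.single (2 : Fin 3) (1 : ℝ)) := by
      rw [hy', hD1pc]
    have hsne : (-s⁻¹ : ℝ) ≠ 0 := by simp [hs.ne']
    have hmi := (HeightDictionary.morseIndex_inner_comp_eq_one_iff (M := sphere (0 : EuclideanSpace ℝ (Fin 3)) 1)
      hdim3 (f := (Φ.trans Φsw) ∘ f) (x := y) ((hfU.contMDiff.contMDiffAt).of_le (by norm_cast)) (hinjU y)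
      (F := FU) ((hFUs.of_le (by norm_cast)).contDiffAt) hZU e₂_ne_zero hsne hcy (hsepU y _ hcy)).1
      (by rw [height_eq] at h1; exact h1)
    obtain ⟨⟨w, -, hneg⟩, -⟩ := hmi
    rw [hy', hD2pc] at hneg
    nlinarith [sq_nonneg (w 0), sq_nonneg (w 1)]
  -- saddles
  have hsaddle : criticalSetOfIndex (𝓡 2) (height ((Φ.trans Φsw) ∘ f)) 1 =
      {y | y ∈ criticalSetOfIndex (𝓡 2) (height f) 1 ∧ f y ∉ Dlow} := by
    ext y
    constructor
    · rintro ⟨hy, h1⟩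
      rcases hclass y hy with ⟨hyc, hyD, -⟩ | hpc'
      · refine ⟨⟨hyc, ?_⟩, hyD⟩
        have := morseIndex_congr_of_eventuallyEq (I := 𝓡 2) (hΘgerm y hyc hyD)
        rw [← this]; exact h1
      · exact absurd h1 (hidxpc y hpc')
    · rintro ⟨⟨hyc, h1⟩, hyD⟩
      have hgerm := hΘgerm y hyc hyD
      exact ⟨(isMCriticalPt_congr_of_eventuallyEq hgerm).2 hyc,
        by rw [morseIndex_congr_of_eventuallyEq hgerm]; exact h1⟩
  -- the level-`0` set: `{F_U = 0} = Θ(f(𝕊²)) ∪ T₀`, `T₀` fixed by `Θ`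
  have hΘT : ∀ t ∈ T₀, (Φ.trans Φsw) t = t := fun t ht => by
    have htZ : FX t = 0 := by
      have h' : t ∈ {x | FX x = 0} := by rw [hZ]; exact Or.inr ht
      exact h'
    have htB : t ∉ closedBox s := fun htB => by
      have := mem_ball_zero_iff.1 (htubeR (closedBox_subset_tube hs hsw hsη htB))
      linarith [hT₀far t ht]
    have htD : t ∉ Dlow := fun htD => hT₀range t ht (hUnion ▸ Or.inr htD)
    have hF₂t : fillFun FX P s δ ((1 + s) ^ 2 + ε₁ + 2) t = 0 := by
      have : Φ t ∈ Φ '' {x | FX x = 0} := ⟨t, htZ, rfl⟩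
      rw [hΦZ, hΦT t ht] at this; exact this
    obtain ⟨h1, -⟩ := hfar t hF₂t htB htD
    rw [hΘapply, hΦT t ht, h1.self_of_nhds]
  have hzeroU : {x | FU x = 0} = range ((Φ.trans Φsw) ∘ f) ∪ T₀ := by
    rw [← himg0, ← hΦZ, Set.image_image, hZ, image_union, ← range_comp]
    congr 1
    ext x; constructor
    · rintro ⟨t, ht, rfl⟩
      show (Φ.trans Φsw) t ∈ T₀
      rw [hΘT t ht]; exact ht
    · intro hx; exact ⟨x, hx, hΘT x hx⟩
  -- `{F₂ = 0} ∖ closedBox = {F_X = 0} ∖ closedBox`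
  have hF₂X : ∀ x, x ∉ closedBox s → (fillFun FX P s δ ((1 + s) ^ 2 + ε₁ + 2) x = 0 ↔ FX x = 0) := by
    intro x hxB
    constructor
    · intro hx
      have : x ∈ Φ '' {x | FX x = 0} := by rw [hΦZ]; exact hx
      obtain ⟨z, hz, hzx⟩ := this
      have hzB : z ∉ closedBox s := fun hzB => hxB (hzx ▸ (hΦbox z).2 hzB)
      rw [← hzx, hΦid z hzB]; exact hz
    · intro hx
      have : Φ x ∈ Φ '' {x | FX x = 0} := ⟨x, hx, rfl⟩
      rw [hΦZ, hΦid x hxB] at this; exact this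
  have hlevelU : range ((Φ.trans Φsw) ∘ f) ∩ {x | x 2 = 0} = (range f ∩ {x | x 2 = 0}) \ (closedBox s ∪ Dlow) := by
    ext x
    simp only [mem_inter_iff, mem_setOf_eq, Set.mem_sdiff, mem_union, not_or]
    constructor
    · rintro ⟨hxr, hx2⟩
      have hxU : FU x = 0 := by obtain ⟨y, rfl⟩ := hxr; exact hZU y
      have hx' : x ∈ {x | FU x = 0 ∧ x 2 = 0} := ⟨hxU, hx2⟩
      rw [hlevel] at hx'
      obtain ⟨hF₂0, -, hB, hD⟩ := hx'
      have hX : FX x = 0 := (hF₂X x hB).1 hF₂0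
      have hxZ : x ∈ {x | FX x = 0} := hX
      rw [hZ] at hxZ
      rcases hxZ with h | hT
      · exact ⟨⟨h, hx2⟩, hB, hD⟩
      · exfalso
        obtain ⟨y, hy⟩ := hxr
        have : (Φ.trans Φsw) (f y) = (Φ.trans Φsw) x := by rw [hΘT x hT]; exact hy
        exact hT₀range x hT ⟨y, (Φ.trans Φsw).injective this⟩
    · rintro ⟨⟨hxr, hx2⟩, hB, hD⟩
      have hX : FX x = 0 := by obtain ⟨y, rfl⟩ := hxr; exact hfZ y
      have hx' : x ∈ {x | fillFun FX P s δ ((1 + s) ^ 2 + ε₁ + 2) x = 0 ∧ x 2 = 0 ∧ x ∉ closedBox s ∧ x ∉ Dlow} :=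
        ⟨(hF₂X x hB).2 hX, hx2, hB, hD⟩
      rw [← hlevel] at hx'
      obtain ⟨hxU, -⟩ := hx'
      have hxU' : x ∈ {x | FU x = 0} := hxU
      rw [hzeroU] at hxU'
      rcases hxU' with h | hT
      · exact ⟨h, hx2⟩
      · exact absurd hxr (hT₀range x hT)
  refine ⟨hZU, hregU, hMorseU, fun y hy => ?_, fun y hy hyD => ⟨hΘfix y hy hyD, hΘgerm y hy hyD⟩, hsaddle, hlevelU⟩
  rcases hclass y hy with ⟨hyc, hyD, hΘy⟩ | hpc'
  · exact Or.inl ⟨hyc, hyD, hΘy, hΘgerm y hyc hyD⟩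
  · exact Or.inr ⟨by rw [hpc', hpc], hpcval y hpc', hidxpc y hpc'⟩

end Swept

/-! ### §B4 The number of level circles drops -/

section Level

variable {f : sphere (0 : EuclideanSpace ℝ (Fin 3)) 1 → EuclideanSpace ℝ (Fin 3)}
  {w₀ η₀ s : ℝ} {Dup Dlow : Set (EuclideanSpace ℝ (Fin 3))}

/-- **The number of level circles at height `0` drops in the step.**  With `L = f(𝕊²) ∩ {x₂ = 0}`
(finitely many components) and the sphere in tube normal form with discs `D₊`, `D₋`: the set
`L ∖ (closedBox ∪ D₋)` — the level set of the swept sphere (`SchoenfliesStep.exists_swept`) — is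
a union of components of `L` missing the unit circle, so it has fewer components
(`AlexanderTools.ncard_components_lt`). [cite: Schultens2014, proof of Thm. 3.2.5 (PDF p. 45)] -/
theorem ncard_components_level_lt (hw₀ : 0 < w₀) (hη₀ : 0 < η₀) (hs : 0 < s) (hsw : 8 * s ≤ w₀)
    (hwall : ∀ x : EuclideanSpace ℝ (Fin 3), hsq x ≤ (1 + 3 * w₀) ^ 2 → |x 2| ≤ η₀ →
      (x ∈ range f ↔ hsq x = 1))
    (hDupc : IsClosed Dup) (hDlowc : IsClosed Dlow) (hUnion : Dup ∪ Dlow = range f)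
    (hInter : Dup ∩ Dlow = {x | hsq x = 1 ∧ x 2 = 0})
    (hfin : {C : Set (EuclideanSpace ℝ (Fin 3)) | ∃ x ∈ range f ∩ {x | x 2 = 0},
      C = connectedComponentIn (range f ∩ {x | x 2 = 0}) x}.Finite) :
    {C : Set (EuclideanSpace ℝ (Fin 3)) | ∃ x ∈ (range f ∩ {x | x 2 = 0}) \ (closedBox s ∪ Dlow),
        C = connectedComponentIn ((range f ∩ {x | x 2 = 0}) \ (closedBox s ∪ Dlow)) x}.ncard <
      {C : Set (EuclideanSpace ℝ (Fin 3)) | ∃ x ∈ range f ∩ {x | x 2 = 0},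
        C = connectedComponentIn (range f ∩ {x | x 2 = 0}) x}.ncard := by
  set L : Set (EuclideanSpace ℝ (Fin 3)) := range f ∩ {x | x 2 = 0} with hL
  set α : Set (EuclideanSpace ℝ (Fin 3)) := {x | hsq x = 1 ∧ x 2 = 0} with hα
  set T : Set (EuclideanSpace ℝ (Fin 3)) := L \ (closedBox s ∪ Dlow) with hT
  -- the circle `α` is in `L` and in the closed box
  have hαL : α ⊆ L := fun x ⟨h1, h2⟩ =>
    ⟨(hwall x (by rw [h1]; nlinarith) (by rw [h2, abs_zero]; exact hη₀.le)).2 h1, h2⟩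
  have hαbox : α ⊆ closedBox s := fun x ⟨h1, h2⟩ => ⟨by rw [h1]; nlinarith, by rw [h2]; linarith, by rw [h2]; linarith⟩
  -- near height `0`, `L` inside the tube is exactly `α`
  have hLtube : ∀ x ∈ L, hsq x < (1 + 3 * w₀) ^ 2 → x ∈ α := fun x ⟨hxr, hx2⟩ hxt =>
    ⟨(hwall x hxt.le (by rw [show x 2 = 0 from hx2, abs_zero]; exact hη₀.le)).1 hxr, hx2⟩
  -- `T = (D₊ ∩ L) ∖ α`
  have hTeq : ∀ x, x ∈ T ↔ x ∈ L ∧ x ∈ Dup ∧ x ∉ α := by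
    intro x
    simp only [hT, Set.mem_sdiff, mem_union, not_or]
    constructor
    · rintro ⟨hxL, hxB, hxD⟩
      have hxr : x ∈ range f := hxL.1
      rw [← hUnion] at hxr
      refine ⟨hxL, hxr.resolve_right hxD, fun hxα => hxB (hαbox hxα)⟩
    · rintro ⟨hxL, hxU, hxα⟩
      refine ⟨hxL, fun hxB => hxα (hLtube x hxL ?_), fun hxD => hxα (hInter.subset ⟨hxU, hxD⟩)⟩
      have h1 := hxB.1
      have hs8 : (1 + 3 * s) ^ 2 < (1 + 3 * w₀) ^ 2 := by nlinarith
      linarith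
  -- a connected subset of `L` through a point off `α` misses `α` (clopen) and stays in its disc
  have hcomp : ∀ x ∈ T, connectedComponentIn L x ⊆ T := by
    intro x hx
    obtain ⟨hxL, hxU, hxα⟩ := (hTeq x).1 hx
    set C := connectedComponentIn L x with hC
    have hCconn : IsPreconnected C := isPreconnected_connectedComponentIn
    have hCL : C ⊆ L := connectedComponentIn_subset _ _
    -- `C` misses `α`: `α` is relatively clopen in `L`
    have hCα : ∀ z ∈ C, z ∉ α := by
      -- `L ∩ {hsq < (1+3w₀)²} = α` is relatively open, and `α` is closed
      by_contra h
      push Not at h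
      obtain ⟨z, hzC, hzα⟩ := h
      have hopen : IsOpen {y : EuclideanSpace ℝ (Fin 3) | hsq y < (1 + 3 * w₀) ^ 2} :=
        isOpen_lt (contDiff_hsq (n := ∞)).continuous continuous_const
      have hclosed : IsClosed α := by
        have h2 : Continuous fun y : EuclideanSpace ℝ (Fin 3) => y 2 := by fun_prop
        exact (isClosed_eq (contDiff_hsq (n := ∞)).continuous continuous_const).inter (isClosed_eq h2 continuous_const)
      -- preconnected `C ⊆ L` meeting both the open set `{hsq < …}` (at `z`) and its complement (at `x`)
      have huniv : C ⊆ {y | hsq y < (1 + 3 * w₀) ^ 2} ∪ αᶜ := fun y _ => by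
        by_cases hy : y ∈ α
        · exact Or.inl (by show hsq y < (1 + 3 * w₀) ^ 2; rw [hy.1]; nlinarith)
        · exact Or.inr hy
      have h1 : (C ∩ {y | hsq y < (1 + 3 * w₀) ^ 2}).Nonempty :=
        ⟨z, hzC, by show hsq z < (1 + 3 * w₀) ^ 2; rw [hzα.1]; nlinarith⟩
      have h2 : (C ∩ αᶜ).Nonempty := ⟨x, mem_connectedComponentIn hxL, hxα⟩
      obtain ⟨y, hyC, hy1, hy2⟩ := hCconn _ _ hopen hclosed.isOpen_compl huniv h1 h2
      exact hy2 (hLtube y (hCL hyC) hy1)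
    -- `C ⊆ L ∖ α ⊆ (Dup ∖ α) ∪ (Dlow ∖ α)`, two relatively closed disjoint pieces; `x ∈ Dup`
    have hsub : C ⊆ (Dup \ α) ∪ (Dlow \ α) := fun z hz => by
      have hzr : z ∈ range f := (hCL hz).1
      rw [← hUnion] at hzr
      rcases hzr with h | h
      · exact Or.inl ⟨h, hCα z hz⟩
      · exact Or.inr ⟨h, hCα z hz⟩
    have hCup : C ⊆ Dup := by
      -- preconnectedness against the open sets `Dlowᶜ`, `Dupᶜ`, whose traces on `C` are disjoint
      by_contra h
      obtain ⟨z, hzC, hzU⟩ := not_subset.1 h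
      have huniv : C ⊆ Dlowᶜ ∪ Dupᶜ := fun y hy => by
        rcases hsub hy with ⟨hyU, hyα⟩ | ⟨hyD, hyα⟩
        · exact Or.inl fun hyD => hyα (hInter.subset ⟨hyU, hyD⟩)
        · exact Or.inr fun hyU => hyα (hInter.subset ⟨hyU, hyD⟩)
      have h1 : (C ∩ Dlowᶜ).Nonempty :=
        ⟨x, mem_connectedComponentIn hxL, fun hxD => hxα (hInter.subset ⟨hxU, hxD⟩)⟩
      have h2 : (C ∩ Dupᶜ).Nonempty := ⟨z, hzC, hzU⟩
      obtain ⟨y, hyC, hy1, hy2⟩ := hCconn _ _ hDlowc.isOpen_compl hDupc.isOpen_compl huniv h1 h2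
      have hyr : y ∈ range f := (hCL hyC).1
      rw [← hUnion] at hyr
      exact hyr.elim hy2 hy1
    intro z hz
    exact (hTeq z).2 ⟨hCL hz, hCup hz, hCα z hz⟩
  -- a point of `α`
  have hx₀ : EuclideanSpace.single (0 : Fin 3) (1 : ℝ) ∈ α := by simp [hα, hsq]
  have hTL : T ⊆ L := fun x hx => hx.1
  exact AlexanderTools.ncard_components_lt hTL hcomp (hαL hx₀) (fun h => ((hTeq _).1 h).2.2 hx₀) hfin

end Level

end Literature.Topology.FourManifolds.SchoenfliesStep
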